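import Summits.BirchSwinnertonDyer.Rank1Residual.SecondDescent.HesseCokernelCartans

/-!
# Hesse-configuration cokernel, part 4: every engine-ADMISSIBLE mod-`3` image contains one of the
# three non-split Cartan subgroups of record — the last informal input of (L1), kernel-checked
# (cell `b2b-bsdres`, CLASS-CLOSURE instrument builder 4 = seat cc-eng-4, GEN 97)

HONEST FRAMING (cell `b2b-bsdres`, run/shared/lean/b2b/bsd-rank1-residual/, verbatim in every
file): the goal of the cell is to DELETE the COMBINATION-SHAPED residual classes of the
Birch–Swinnerton-Dyer formula for ALL analytic-rank `≤ 1` elliptic curves over `ℚ` — "full BSD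
formula for every rank `≤ 1` curve in class `C`" assembled STRICTLY from published theorems — so
that the rank-`≤ 1` remainder becomes exactly the CONSTRUCTION-SHAPED classes, which are TYPED
(missing-input `Prop`s), NOT attempted. This is not "finishing BSD". THIS FILE is a class-free TOOL
file continuing `HesseCokernelInvariants.lean` / `HesseCokernelCartans.lean` (same notation; finite
statements about `GL₂(𝔽₃)` and `S₄` checked by `decide` / `decide +kernel`, plus their short
assembly); NOT a Literature fact, NOT a class theorem; closes no item, books nothing, moves no
RESIDUAL-MAP mark.

## What this part adds

Parts 1–3 proved (L1) of `class-closure/eng-4/b1/stage/SEL3ALT-0.3.3-dev/README-DEV33.md` §7.1 —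
`H⁰(𝔽₃² ⋊ ⟨cᵢ⟩, Map(Y₂, 𝔽₃) ⧸ ∂₂Map(X, 𝔽₃)) = 0` — for each of the THREE non-split Cartan subgroups
`⟨c₁⟩ = ⟨cLin⟩`, `⟨c₂⟩ = ⟨cLin2⟩`, `⟨c₃⟩ = ⟨cLin3⟩` of `GL₂(𝔽₃)` in the fixed flex coordinates, and
recorded as 'the remaining informal input' the enumeration of `kvtable/hesse_h0Q.py`: *every
subgroup `H ≤ GL₂(𝔽₃)` with `det H = 𝔽₃ˣ` acting transitively on `ℙ¹(𝔽₃)` is a non-split Cartan,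
its normaliser `SD₁₆`, or `GL₂(𝔽₃)` — so it contains a non-split Cartan*. Those are exactly the
mod-`3` images the engines ACCEPT (the mod-`3` cyclotomic character = `det` is onto over `ℚ`, and
the engines' irreducibility test on the `3`-division polynomial `ψ₃` — whose four roots up to sign
are the four lines of `E[3]` — is transitivity on `ℙ¹(𝔽₃)`). This file proves the enumeration in
the form the instrument needs, with NO appeal to a classification of subgroups:

* `exists_pow_four_eq_neg_one` — if `S ⊆ GL₂(𝔽₃)` (matrices with `det ≠ 0`) is closed under
  products, moves the line `ℓ₀ = 𝔽₃·(1,0)` to each of the other three lines, and contains a matrix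
  of determinant `−1`, then `S` contains a matrix `M` with `M⁴ = −1` (an element of order `8`);
* `exists_cartan_generator_mem` — hence `cLin ∈ S ∨ cLin2 ∈ S ∨ cLin3 ∈ S` (every element of
  order `8` has one of the three recorded generators among its powers: `exists_pow_eq_cartan`);
* `exists_preimage_of_invariant_of_admissible` — (L1) FOR EVERY ADMISSIBLE IMAGE: a line function
  `ψ : Y₂ → 𝔽₃` invariant modulo `im ∂₂` under the two translations and under every recorded Cartan
  generator lying in `S` is in `im ∂₂` (by part 1 / part 3 for the generator found).

Method. `projAct M : Fin 4 → Fin 4` is the permutation of the four lines (`lineRep`, `lineIdx`)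
induced by `M`; it is multiplicative on invertible matrices (`projAct_mul`, from the `±`-
representative lemma `eq_or_eq_neg_lineRep`). In `S₄ ≅ PGL₂(𝔽₃)` the key fact is checked by
`decide`: for `ā(0) = 1`, `b̄(0) = 2`, `c̄(0) = 3` and `d̄` odd (`det = −1 ↔ odd`, `projAct_mem_oddPerms`)
some word of length `≤ 3` in `ā, b̄, c̄, d̄` is a `4`-cycle (`key_S4`; length `2` does NOT suffice —
`21` of the `2592` tuples need a triple product); a matrix whose line permutation is a `4`-cycle
has `M⁴ = −1` (`pow_four_eq_neg_one_of_fourCycle`), and words in elements of `S` stay in `S`.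
All finite checks were first reproduced by a stdlib script on the hub (seat folder
`work/l1enum/explore.py`).
-/

namespace Summit.BirchSwinnertonDyer.Rank1Residual.SecondDescent.HesseCokernel

open Matrix

/-! ## `ℙ¹(𝔽₃)`: the four lines through the origin, and the line permutation of a matrix -/

/-- Representatives of the four lines of `𝔽₃²` through `0`: `(1,0), (0,1), (1,1), (1,2)`. -/
def lineRep : Fin 4 → Fin 2 → ZMod 3 := ![![1, 0], ![0, 1], ![1, 1], ![1, 2]]

/-- The line through a vector `w = (a, b) ≠ 0`: index `1` if `a = 0`, else `0`, `2`, `3` according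
as `b = 0`, `b = a`, `b = −a` (the value at `w = 0` is immaterial). -/
def lineIdx (w : Fin 2 → ZMod 3) : Fin 4 :=
  if w 0 = 0 then 1 else if w 1 = 0 then 0 else if w 1 = w 0 then 2 else 3

/-- `lineIdx` inverts `lineRep`. -/
theorem lineIdx_lineRep : ∀ i : Fin 4, lineIdx (lineRep i) = i := by decide

/-- The representatives are non-zero. -/
theorem lineRep_ne_zero : ∀ i : Fin 4, lineRep i ≠ 0 := by decide

/-- Every non-zero vector of `𝔽₃²` is `±` the representative of its line (so `lineIdx` classifies
`ℙ¹(𝔽₃)`: `9 − 1 = 4 · 2` vectors). -/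
theorem eq_or_eq_neg_lineRep : ∀ w : Fin 2 → ZMod 3, w ≠ 0 →
    w = lineRep (lineIdx w) ∨ w = -lineRep (lineIdx w) := by decide

/-- `lineIdx` is constant on `{w, −w}`. -/
theorem lineIdx_neg : ∀ w : Fin 2 → ZMod 3, lineIdx (-w) = lineIdx w := by decide

/-- The permutation of `ℙ¹(𝔽₃)` induced by a matrix acting on column vectors:
line `i ↦` the line of `M · lineRep i`. -/
def projAct (M : Matrix (Fin 2) (Fin 2) (ZMod 3)) : Fin 4 → Fin 4 := fun i => lineIdx (M *ᵥ lineRep i)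

/-- An invertible matrix moves the line representatives to non-zero vectors (entries form). -/
theorem mulVec_lineRep_ne_zero_entries : ∀ a b c d : ZMod 3, a * d - b * c ≠ 0 →
    ∀ i : Fin 4, !![a, b; c, d] *ᵥ lineRep i ≠ 0 := by decide +kernel

/-- An invertible matrix moves the line representatives to non-zero vectors. -/
theorem mulVec_lineRep_ne_zero (M : Matrix (Fin 2) (Fin 2) (ZMod 3)) (hM : M.det ≠ 0) (i : Fin 4) :
    M *ᵥ lineRep i ≠ 0 := by
  rw [Matrix.det_fin_two] at hM
  rw [Matrix.eta_fin_two M]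
  exact mulVec_lineRep_ne_zero_entries _ _ _ _ hM i

/-- `projAct` is multiplicative on matrices whose right factor moves lines to non-zero vectors
(in particular on `GL₂(𝔽₃)`): the action on `ℙ¹(𝔽₃)` is a homomorphism to `S₄`. -/
theorem projAct_mul (M N : Matrix (Fin 2) (Fin 2) (ZMod 3)) (hN : ∀ i, N *ᵥ lineRep i ≠ 0) :
    projAct (M * N) = projAct M ∘ projAct N := by
  funext i
  show lineIdx ((M * N) *ᵥ lineRep i) = lineIdx (M *ᵥ lineRep (lineIdx (N *ᵥ lineRep i)))
  rw [← Matrix.mulVec_mulVec]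
  have hw0 : N *ᵥ lineRep i ≠ 0 := hN i
  generalize N *ᵥ lineRep i = w at hw0 ⊢
  rcases eq_or_eq_neg_lineRep w hw0 with h | h
  · conv_lhs => rw [h]
  · conv_lhs => rw [h, Matrix.mulVec_neg, lineIdx_neg]

/-- `projAct M` is injective (a permutation of the four lines) for `M` invertible (entries form). -/
theorem projAct_injective_entries : ∀ a b c d : ZMod 3, a * d - b * c ≠ 0 →
    Function.Injective (projAct !![a, b; c, d]) := by decide +kernel

/-- `projAct M` is a permutation of the four lines for `M` invertible. -/
theorem projAct_injective (M : Matrix (Fin 2) (Fin 2) (ZMod 3)) (hM : M.det ≠ 0) :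
    Function.Injective (projAct M) := by
  rw [Matrix.det_fin_two] at hM
  rw [Matrix.eta_fin_two M]
  exact projAct_injective_entries _ _ _ _ hM

/-! ## `4`-cycles on `ℙ¹(𝔽₃)` lift to elements of order `8` -/

/-- A permutation `σ` of four points is a `4`-cycle iff `σ ∘ σ` has no fixed point; this file
writes that predicate inline as `∀ x, σ (σ x) ≠ x`. If the line permutation of an invertible `M`
is a `4`-cycle then `M⁴ = −1`, i.e. `M` has order `8` and generates a non-split Cartan subgroup
(entries form; the converse also holds). -/
theorem pow_four_eq_neg_one_of_fourCycle_entries : ∀ a b c d : ZMod 3, a * d - b * c ≠ 0 →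
    (∀ x, projAct !![a, b; c, d] (projAct !![a, b; c, d] x) ≠ x) → !![a, b; c, d] ^ 4 = -1 := by
  decide +kernel

/-- If the line permutation of an invertible `M` is a `4`-cycle then `M⁴ = −1`. -/
theorem pow_four_eq_neg_one_of_fourCycle (M : Matrix (Fin 2) (Fin 2) (ZMod 3)) (hM : M.det ≠ 0)
    (h : ∀ x, projAct M (projAct M x) ≠ x) : M ^ 4 = -1 := by
  rw [Matrix.det_fin_two] at hM
  rw [Matrix.eta_fin_two M] at h ⊢
  exact pow_four_eq_neg_one_of_fourCycle_entries _ _ _ _ hM h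

/-- Conversely the three recorded Cartan generators act on `ℙ¹(𝔽₃)` as `4`-cycles. -/
theorem fourCycle_projAct_cartan : (∀ x, projAct cLin (projAct cLin x) ≠ x) ∧
    (∀ x, projAct cLin2 (projAct cLin2 x) ≠ x) ∧ (∀ x, projAct cLin3 (projAct cLin3 x) ≠ x) := by
  decide +kernel

/-- Every matrix with `M⁴ = −1` (an element of order `8` of `GL₂(𝔽₃)`) has one of the three recorded
non-split Cartan generators `cLin`, `cLin2`, `cLin3` among its powers `M^(k+1)`, `k < 8` (entries
form). So the three cyclic groups `⟨cᵢ⟩` of `HesseCokernelCartans` ARE all the non-split Cartan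
subgroups of `GL₂(𝔽₃)` (each has the `4` generators `cᵢ, cᵢ³, cᵢ⁵, cᵢ⁷`; `3 · 4 = 12` elements of
order `8`). -/
theorem exists_pow_eq_cartan_entries : ∀ a b c d : ZMod 3, !![a, b; c, d] ^ 4 = -1 →
    ∃ k : Fin 8, !![a, b; c, d] ^ ((k : ℕ) + 1) = cLin ∨ !![a, b; c, d] ^ ((k : ℕ) + 1) = cLin2 ∨
      !![a, b; c, d] ^ ((k : ℕ) + 1) = cLin3 := by decide +kernel

/-- Every matrix with `M⁴ = −1` has a recorded Cartan generator among its positive powers. -/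
theorem exists_pow_eq_cartan (M : Matrix (Fin 2) (Fin 2) (ZMod 3)) (h : M ^ 4 = -1) :
    ∃ k : Fin 8, M ^ ((k : ℕ) + 1) = cLin ∨ M ^ ((k : ℕ) + 1) = cLin2 ∨ M ^ ((k : ℕ) + 1) = cLin3 := by
  rw [Matrix.eta_fin_two M] at h ⊢
  exact exists_pow_eq_cartan_entries _ _ _ _ h

/-! ## The `S₄` key fact: transitive + odd ⇒ a `4`-cycle among words of length `≤ 3` -/

/-- The six permutations of `Fin 4` sending `0 ↦ 1`. -/
def permsTo1 : List (Fin 4 → Fin 4) :=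
  [![1, 0, 2, 3], ![1, 0, 3, 2], ![1, 2, 0, 3], ![1, 2, 3, 0], ![1, 3, 0, 2], ![1, 3, 2, 0]]

/-- The six permutations of `Fin 4` sending `0 ↦ 2`. -/
def permsTo2 : List (Fin 4 → Fin 4) :=
  [![2, 0, 1, 3], ![2, 0, 3, 1], ![2, 1, 0, 3], ![2, 1, 3, 0], ![2, 3, 0, 1], ![2, 3, 1, 0]]

/-- The six permutations of `Fin 4` sending `0 ↦ 3`. -/
def permsTo3 : List (Fin 4 → Fin 4) :=
  [![3, 0, 1, 2], ![3, 0, 2, 1], ![3, 1, 0, 2], ![3, 1, 2, 0], ![3, 2, 0, 1], ![3, 2, 1, 0]]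

/-- The twelve odd permutations of `Fin 4` (six transpositions, six `4`-cycles). -/
def oddPerms : List (Fin 4 → Fin 4) :=
  [![0, 1, 3, 2], ![0, 2, 1, 3], ![0, 3, 2, 1], ![1, 0, 2, 3], ![1, 2, 3, 0], ![1, 3, 0, 2],
   ![2, 0, 3, 1], ![2, 1, 0, 3], ![2, 3, 1, 0], ![3, 0, 1, 2], ![3, 1, 2, 0], ![3, 2, 0, 1]]

/-- `permsTo1` lists every injective `σ` with `σ 0 = 1`. -/
theorem mem_permsTo1 : ∀ σ : Fin 4 → Fin 4, Function.Injective σ → σ 0 = 1 → σ ∈ permsTo1 := by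
  decide +kernel

/-- `permsTo2` lists every injective `σ` with `σ 0 = 2`. -/
theorem mem_permsTo2 : ∀ σ : Fin 4 → Fin 4, Function.Injective σ → σ 0 = 2 → σ ∈ permsTo2 := by
  decide +kernel

/-- `permsTo3` lists every injective `σ` with `σ 0 = 3`. -/
theorem mem_permsTo3 : ∀ σ : Fin 4 → Fin 4, Function.Injective σ → σ 0 = 3 → σ ∈ permsTo3 := by
  decide +kernel

/-- `det M = −1` ⇒ the line permutation of `M` is odd (it lies in `oddPerms`): `det` on `GL₂(𝔽₃)`
descends to the sign character of `PGL₂(𝔽₃) ≅ S₄` (entries form). -/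
theorem projAct_mem_oddPerms_entries : ∀ a b c d : ZMod 3, a * d - b * c = -1 →
    projAct !![a, b; c, d] ∈ oddPerms := by decide +kernel

/-- `det M = −1` ⇒ the line permutation of `M` is odd. -/
theorem projAct_mem_oddPerms (M : Matrix (Fin 2) (Fin 2) (ZMod 3)) (hM : M.det = -1) :
    projAct M ∈ oddPerms := by
  rw [Matrix.det_fin_two] at hM
  rw [Matrix.eta_fin_two M]
  exact projAct_mem_oddPerms_entries _ _ _ _ hM

/-- `true` iff some left-nested word of length `≤ 3` in the four letters `g 0, …, g 3` satisfies
the decidable predicate `P` (a `Bool`-valued search over the `4 + 16 + 64` words). -/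
def wordHits {α : Type*} (op : α → α → α) (g : Fin 4 → α) (P : α → Prop) [DecidablePred P] : Bool :=
  decide ((∃ i, P (g i)) ∨ (∃ i j, P (op (g i) (g j))) ∨ ∃ i j k, P (op (op (g i) (g j)) (g k)))

/-- Unfolding of `wordHits = true`. -/
theorem wordHits_eq_true_iff {α : Type*} (op : α → α → α) (g : Fin 4 → α) (P : α → Prop)
    [DecidablePred P] : wordHits op g P = true ↔
      (∃ i, P (g i)) ∨ (∃ i j, P (op (g i) (g j))) ∨ ∃ i j k, P (op (op (g i) (g j)) (g k)) :=
  decide_eq_true_iff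

/-- **Key `S₄` fact.** If `ā(0) = 1`, `b̄(0) = 2`, `c̄(0) = 3` (so `⟨ā, b̄, c̄⟩` is transitive on
`Fin 4`) and `d̄` is odd, then some word of length `≤ 3` in `ā, b̄, c̄, d̄` is a `4`-cycle — i.e.
every transitive subgroup of `S₄` not contained in `A₄` contains a `4`-cycle, in a word-explicit
form (`2592` tuples; words of length `≤ 2` fail for `21` of them). -/
theorem key_S4 : ∀ a ∈ permsTo1, ∀ b ∈ permsTo2, ∀ c ∈ permsTo3, ∀ d ∈ oddPerms,
    wordHits (· ∘ ·) ![a, b, c, d] (fun σ : Fin 4 → Fin 4 => ∀ x, σ (σ x) ≠ x) = true := by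
  decide +kernel

/-- Words map along a map that is multiplicative on a product-closed predicate: a hit among the
words in `f ∘ g` for `P` is a hit among the words in `g` for `P ∘ f`. -/
theorem wordHits_of_comp {α β : Type*} (op₁ : α → α → α) (op₂ : β → β → β) (f : α → β)
    (Q : α → Prop) (hQ : ∀ u v, Q u → Q v → Q (op₁ u v))
    (hf : ∀ u v, Q u → Q v → f (op₁ u v) = op₂ (f u) (f v)) (P : β → Prop) (g : Fin 4 → α)
    (hg : ∀ i, Q (g i))
    (h : (∃ i, P ((f ∘ g) i)) ∨ (∃ i j, P (op₂ ((f ∘ g) i) ((f ∘ g) j))) ∨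
      ∃ i j k, P (op₂ (op₂ ((f ∘ g) i) ((f ∘ g) j)) ((f ∘ g) k))) :
    (∃ i, P (f (g i))) ∨ (∃ i j, P (f (op₁ (g i) (g j)))) ∨
      ∃ i j k, P (f (op₁ (op₁ (g i) (g j)) (g k))) := by
  rcases h with ⟨i, h⟩ | ⟨i, j, h⟩ | ⟨i, j, k, h⟩
  · exact Or.inl ⟨i, h⟩
  · refine Or.inr (Or.inl ⟨i, j, ?_⟩)
    rw [hf _ _ (hg i) (hg j)]
    exact h
  · refine Or.inr (Or.inr ⟨i, j, k, ?_⟩)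
    rw [hf _ _ (hQ _ _ (hg i) (hg j)) (hg k), hf _ _ (hg i) (hg j)]
    exact h

/-- Words in elements of a product-closed set stay in the set. -/
theorem exists_mem_of_wordHits {α : Type*} (op : α → α → α) (S : Set α)
    (hS : ∀ u ∈ S, ∀ v ∈ S, op u v ∈ S) (P : α → Prop) (g : Fin 4 → α) (hg : ∀ i, g i ∈ S)
    (h : (∃ i, P (g i)) ∨ (∃ i j, P (op (g i) (g j))) ∨ ∃ i j k, P (op (op (g i) (g j)) (g k))) :
    ∃ x ∈ S, P x := by
  rcases h with ⟨i, h⟩ | ⟨i, j, h⟩ | ⟨i, j, k, h⟩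
  · exact ⟨_, hg i, h⟩
  · exact ⟨_, hS _ (hg i) _ (hg j), h⟩
  · exact ⟨_, hS _ (hS _ (hg i) _ (hg j)) _ (hg k), h⟩

/-- Positive powers of an element of a product-closed set stay in the set. -/
theorem pow_succ_mem {α : Type*} [Monoid α] (S : Set α) (hS : ∀ u ∈ S, ∀ v ∈ S, u * v ∈ S)
    (x : α) (hx : x ∈ S) : ∀ k : ℕ, x ^ (k + 1) ∈ S
  | 0 => by rwa [zero_add, pow_one]
  | k + 1 => by rw [pow_succ]; exact hS _ (pow_succ_mem S hS x hx k) _ hx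

/-- `𝔽₃` has no zero divisors (kept elementary: `decide`). -/
theorem zmod3_mul_ne_zero : ∀ x y : ZMod 3, x ≠ 0 → y ≠ 0 → x * y ≠ 0 := by decide

/-! ## Assembly: admissible images contain a non-split Cartan generator of record -/

/-- **Transitive on `ℙ¹(𝔽₃)` + `det` onto ⇒ an element of order `8`.** Let `S` be a set of
invertible `2 × 2` matrices over `𝔽₃` closed under products (e.g. a subgroup of `GL₂(𝔽₃)` — the
mod-`3` image of Galois), moving the line `𝔽₃·(1,0)` to each of the three other lines (with
closure: transitive on `ℙ¹(𝔽₃)` ⟸ `ψ₃` irreducible) and containing a matrix of determinant `−1`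
(`det` = the mod-`3` cyclotomic character is onto over `ℚ`). Then `S` contains `M` with `M⁴ = −1`. -/
theorem exists_pow_four_eq_neg_one (S : Set (Matrix (Fin 2) (Fin 2) (ZMod 3)))
    (hmul : ∀ M ∈ S, ∀ N ∈ S, M * N ∈ S) (hdet : ∀ M ∈ S, M.det ≠ 0)
    (h1 : ∃ M ∈ S, projAct M 0 = 1) (h2 : ∃ M ∈ S, projAct M 0 = 2) (h3 : ∃ M ∈ S, projAct M 0 = 3)
    (hodd : ∃ M ∈ S, M.det = -1) : ∃ M ∈ S, M ^ 4 = -1 := by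
  obtain ⟨a, ha, ha0⟩ := h1
  obtain ⟨b, hb, hb0⟩ := h2
  obtain ⟨c, hc, hc0⟩ := h3
  obtain ⟨d, hd, hdd⟩ := hodd
  have key := (wordHits_eq_true_iff _ _ _).mp (key_S4 (projAct a)
    (mem_permsTo1 _ (projAct_injective a (hdet a ha)) ha0)
    (projAct b) (mem_permsTo2 _ (projAct_injective b (hdet b hb)) hb0)
    (projAct c) (mem_permsTo3 _ (projAct_injective c (hdet c hc)) hc0)
    (projAct d) (projAct_mem_oddPerms d hdd))
  have hg : ![projAct a, projAct b, projAct c, projAct d] = (projAct ∘ ![a, b, c, d]) := by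
    funext i; fin_cases i <;> rfl
  rw [hg] at key
  have hQ : ∀ u v : Matrix (Fin 2) (Fin 2) (ZMod 3), u.det ≠ 0 → v.det ≠ 0 → (u * v).det ≠ 0 :=
    fun u v hu hv => by rw [Matrix.det_mul]; exact zmod3_mul_ne_zero _ _ hu hv
  have hf : ∀ u v : Matrix (Fin 2) (Fin 2) (ZMod 3), u.det ≠ 0 → v.det ≠ 0 →
      projAct (u * v) = projAct u ∘ projAct v :=
    fun u v _ hv => projAct_mul u v (mulVec_lineRep_ne_zero v hv)
  have hgS : ∀ i, ![a, b, c, d] i ∈ S := by intro i; fin_cases i <;> assumption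
  have key' := wordHits_of_comp (· * ·) (· ∘ ·) projAct (fun u => u.det ≠ 0) hQ hf
    (fun σ : Fin 4 → Fin 4 => ∀ x, σ (σ x) ≠ x) ![a, b, c, d] (fun i => hdet _ (hgS i)) key
  obtain ⟨w, hwS, hw⟩ := exists_mem_of_wordHits (· * ·) S hmul
    (fun M => ∀ x, projAct M (projAct M x) ≠ x) ![a, b, c, d] hgS key'
  exact ⟨w, hwS, pow_four_eq_neg_one_of_fourCycle w (hdet w hwS) hw⟩

/-- **Every admissible mod-`3` image contains a non-split Cartan generator of record.** Under the
hypotheses of `exists_pow_four_eq_neg_one`, one of `cLin`, `cLin2`, `cLin3` lies in `S` — the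
enumeration 'det-surjective + `ℙ¹(𝔽₃)`-transitive ⇒ `C_ns` / `SD₁₆` / `GL₂(𝔽₃)` ⊇ `C_ns`' of
README-DEV33 §7.1 in the form (L1) consumes, without a subgroup classification. -/
theorem exists_cartan_generator_mem (S : Set (Matrix (Fin 2) (Fin 2) (ZMod 3)))
    (hmul : ∀ M ∈ S, ∀ N ∈ S, M * N ∈ S) (hdet : ∀ M ∈ S, M.det ≠ 0)
    (h1 : ∃ M ∈ S, projAct M 0 = 1) (h2 : ∃ M ∈ S, projAct M 0 = 2) (h3 : ∃ M ∈ S, projAct M 0 = 3)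
    (hodd : ∃ M ∈ S, M.det = -1) : cLin ∈ S ∨ cLin2 ∈ S ∨ cLin3 ∈ S := by
  obtain ⟨M, hM, h4⟩ := exists_pow_four_eq_neg_one S hmul hdet h1 h2 h3 hodd
  obtain ⟨k, hk⟩ := exists_pow_eq_cartan M h4
  have hp : M ^ ((k : ℕ) + 1) ∈ S := pow_succ_mem S hmul M hM k
  rcases hk with h | h | h
  · exact Or.inl (h ▸ hp)
  · exact Or.inr (Or.inl (h ▸ hp))
  · exact Or.inr (Or.inr (h ▸ hp))

/-- **(L1) for every engine-admissible mod-`3` image.** With `S` as above (the linear part of the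
Galois action on the flex torsor `X ≅ AG(2,3)` in the fixed coordinates `pt`), a line function
`ψ : Y₂ → 𝔽₃` that is invariant modulo `im ∂₂` under the two translations and under each recorded
Cartan generator that lies in `S` (as it is when `ψ` represents a Galois-invariant class of
`Map(Y₂, μ₃) ⧸ ∂₂ Map(X, μ₃)` and the translations are in the image — README-DEV33 §7.1: 'full
because `ξ ≠ 0`') lies in `im ∂₂`: `H⁰ = 0` for ALL admissible images, the soundness lemma behind
RULE K-VIS/2 of `SEL3ALT-0.3.x`. -/
theorem exists_preimage_of_invariant_of_admissible (S : Set (Matrix (Fin 2) (Fin 2) (ZMod 3)))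
    (hmul : ∀ M ∈ S, ∀ N ∈ S, M * N ∈ S) (hdet : ∀ M ∈ S, M.det ≠ 0)
    (h1 : ∃ M ∈ S, projAct M 0 = 1) (h2 : ∃ M ∈ S, projAct M 0 = 2) (h3 : ∃ M ∈ S, projAct M 0 = 3)
    (hodd : ∃ M ∈ S, M.det = -1) (ψ : Fin 12 → ZMod 3)
    (ht1 : ∃ φ, inc *ᵥ φ = actY_t1 *ᵥ ψ - ψ) (ht2 : ∃ φ, inc *ᵥ φ = actY_t2 *ᵥ ψ - ψ)
    (hc1 : cLin ∈ S → ∃ φ, inc *ᵥ φ = actY_c *ᵥ ψ - ψ)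
    (hc2 : cLin2 ∈ S → ∃ φ, inc *ᵥ φ = actY_c2 *ᵥ ψ - ψ)
    (hc3 : cLin3 ∈ S → ∃ φ, inc *ᵥ φ = actY_c3 *ᵥ ψ - ψ) : ∃ φ, inc *ᵥ φ = ψ := by
  rcases exists_cartan_generator_mem S hmul hdet h1 h2 h3 hodd with h | h | h
  · exact exists_preimage_of_invariant ψ ht1 ht2 (hc1 h)
  · exact exists_preimage_of_invariant_c2 ψ ht1 ht2 (hc2 h)
  · exact exists_preimage_of_invariant_c3 ψ ht1 ht2 (hc3 h)

end Summit.BirchSwinnertonDyer.Rank1Residual.SecondDescent.HesseCokernel
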